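import Summits.MatrixMultiplication.OmegaCensus.STPP222IcosetClassNoneK6

/-!
# ω-census, icoset class negatives, KERNEL: no involution-coset `(2,2,2)⁶` family in `𝔽₂³ × ℤ₃²` (order 72)

HONEST FRAMING (pub-omega census; verbatim): lottery ticket; floor = certified bounds/negative ranges.
Census STRUCTURE bookkeeping (question Q7; a CLASS-INTERNAL negative — nothing about unrestricted `(2,2,2)⁶` families, nothing about `ω`).
Companion of `STPP222IcosetClassNoneK6.lean`: the H-stage search for `H = ℤ₃ × ℤ₃` (code arithmetic `z33`, encoding `encZ33`; 12 043 DFS nodes,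
no slot-consistent leaf — the engine-grade NONE of `ICOSET-NOTE.md`) evaluated by `decide +kernel` and pushed through `Icoset.not_exists_of_check`.
References: H. Cohn, R. Kleinberg, B. Szegedy, C. Umans, FOCS 2005 (arXiv:math/0511460), Def. 5.1.  Seat pub-omega-kernel-l4 (gen 19), 2026-08-27.
-/

namespace Summit.MatrixMultiplication.OmegaCensus

open Literature.Computability.AlgebraicComplexity

namespace IcosetH

/-- Kernel evaluation: the H-stage search for `ℤ₃ × ℤ₃`, `K = 6` (12 043 nodes). -/
theorem check_z33_six : check z33 6 = true := by decide +kernel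

end IcosetH

/-- **`𝔽₂³ × ℤ₃²` (order 72) has no involution-coset `(2,2,2)⁶` STPP family** — KERNEL (class-internal negative; the unrestricted
cell ℤ₂³×ℤ₃² is INFEASIBLE at engine grade, Pb120). [cite: CohnKleinbergSzegedyUmans2005, Def. 5.1] -/
theorem no_icoset_pow6_F2cube_zmod3_sq :
    ¬ ∃ A B C : Fin 6 → Finset ((ZMod 2 × ZMod 2 × ZMod 2) × (ZMod 3 × ZMod 3)),
      Icoset.IsIcosetFamily A B C ∧ IsSTPP A B C :=
  Icoset.not_exists_of_check IcosetH.finrank_F2_cube IcosetH.encZ33 (by norm_num) IcosetH.check_z33_six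

end Summit.MatrixMultiplication.OmegaCensus
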